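import Summits.KontsevichZagierPeriods.KontsevichZagierPeriods.Theorems.RootDecompWalshStrataSectorSpecimenP1

/-! # `RootDecompWalshStrataSectorSpecimen` — part 2/2 of the mechanical ≤330-line split of `RootDecompWalshStrataSectorSpecimen.lean`
(split by the decomp-kz census seat for landing; mathematics unchanged; part 2 continues part 1). -/

noncomputable section
open Set MeasureTheory MvPolynomial Literature.NumberTheory.Transcendental
open Literature.ModelTheory.ExponentialFields (IsSemialgebraic isSemialgebraic_univ isSemialgebraic_setOf_eval_pos
  isSemialgebraic_setOf_eval_eq_zero isSemialgebraic_setOf_eval_lt)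

namespace Summit.KontsevichZagierPeriods.RootDecompWalshStrata.ConicDescent.BallCube
variable {κ₀ κ₁ : ℚ}

/-! (private copy of `snoc2_zero` — dedup.landed / split policy; origin part RootDecompWalshStrataSectorSpecimenP1) -/
/-- `(x, t)₀ = x₀` on `Fin 2` (rfl helper; the landed twins are private). [folklore] -/
@[simp] private theorem snoc2_zero (x : Fin 1 → ℝ) (t : ℝ) : (Fin.snoc x t : Fin 2 → ℝ) 0 = x 0 := rfl

/-! (private copy of `snoc2_one` — dedup.landed / split policy; origin part RootDecompWalshStrataSectorSpecimenP1) -/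
/-- `(x, t)₁ = t` on `Fin 2` (rfl helper). [folklore] -/
@[simp] private theorem snoc2_one (x : Fin 1 → ℝ) (t : ℝ) : (Fin.snoc x t : Fin 2 → ℝ) 1 = t := rfl

/-- **BOUNDARY SECTIONS OF THE SPECIMEN.**  Every section term `[S, P(t, ζ t)]` of the primitive over a
continuous semialgebraic `ζ` with graph in the frontier of the chart domain lies in the Baker sector:
cover `S` by the pulled-back walls (`specA_frontier`) and treat each hereditarily (`InBaker.of_cover`):
endpoints `t ∈ {0, 1}` — a null zero set (rule (1a)); the wall `x = 1` — the landed Euler terminal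
`InBaker.sqrt_rational` for `(γ/9)(3t² + 2)/(1 + t²)·√(3t² + 2)` on `[0, 1]`; the wall `D = 0` — the
integrand vanishes. [KontsevichZagier2001 §1.2; this node] -/
theorem inBaker_specA_section (γ : ℚ) (S : Set (Fin 1 → ℝ)) (ζ : (Fin 1 → ℝ) → ℝ)
    (hS : IsSemialgebraic ℚ S) (hζ : IsSemialgebraicFunOn ℚ S ζ)
    (hfr : ∀ x ∈ S, Fin.snoc x (ζ x) ∈ frontier (pchartDom (1 / 2) (1 / 2) specA))
    (r₁ : KZ.IntegralRep 1) (hr₁ : r₁.domain = S)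
    (hint : EqOn r₁.integrand (fun x => ppot (1 / 2) (1 / 2) γ 6 (-1) (Fin.snoc x (ζ x))) S) :
    InBaker (KZ.of r₁) := by
  classical
  have hw : ∀ x ∈ S, (0 ≤ x 0 ∧ x 0 ≤ 1) ∧ 0 < ζ x ∧
      (x 0 = 0 ∨ x 0 = 1 ∨ 2 * ζ x ^ 2 = 1 + x 0 ^ 2 ∨ 6 * ζ x ^ 2 = 1) := fun x hx => by
    simpa only [snoc2_zero, snoc2_one] using specA_frontier (hfr x hx)
  have hZ : IsSemialgebraic ℚ
      {x : Fin 1 → ℝ | aeval x (X 0 * (X 0 - 1) : MvPolynomial (Fin 1) ℚ) = 0} :=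
    isSemialgebraic_setOf_eval_eq_zero _
  have hL : IsSemialgebraic ℚ {x | x ∈ S ∧ 2 * ζ x ^ 2 = 1 + x 0 ^ 2} := by
    refine isSemialgebraic_sep_eq ?_ ?_
    · exact ((isSemialgebraicFunOn_ratCast hS 2).mul_holds (hζ.mul_holds hζ)).congr fun x _ => by
        simp only [Pi.mul_apply]; push_cast; ring
    · exact (isSemialgebraicFunOn_aeval hS (1 + X 0 ^ 2 : MvPolynomial (Fin 1) ℚ)).congr
        fun x _ => by simp
  have hD : IsSemialgebraic ℚ {x | x ∈ S ∧ 6 * ζ x ^ 2 = 1} := by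
    refine isSemialgebraic_sep_eq ?_ ?_
    · exact ((isSemialgebraicFunOn_ratCast hS 6).mul_holds (hζ.mul_holds hζ)).congr fun x _ => by
        simp only [Pi.mul_apply]; push_cast; ring
    · exact (isSemialgebraicFunOn_ratCast hS 1).congr fun x _ => by simp
  have hTS₀ : r₁.domain ⊆ S := hr₁.le
  refine InBaker.of_cover r₁
    ![{x : Fin 1 → ℝ | aeval x (X 0 * (X 0 - 1) : MvPolynomial (Fin 1) ℚ) = 0},
      {x | x ∈ S ∧ 2 * ζ x ^ 2 = 1 + x 0 ^ 2}, {x | x ∈ S ∧ 6 * ζ x ^ 2 = 1}] ?_ ?_ ?_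
  · intro i
    fin_cases i
    · exact hZ
    · exact hL
    · exact hD
  · intro x hx
    have hxS : x ∈ S := hTS₀ hx
    rcases (hw x hxS).2.2 with h | h | h | h
    · exact mem_iUnion.2 ⟨0, by simp [h]⟩
    · exact mem_iUnion.2 ⟨0, by simp [h]⟩
    · exact mem_iUnion.2 ⟨1, hxS, h⟩
    · exact mem_iUnion.2 ⟨2, hxS, h⟩
  · intro i T hT hTr hTA
    have hTS : T ⊆ S := fun v hv => hTS₀ (hTr hv)
    fin_cases i
    · -- endpoints `t ∈ {0, 1}`: null
      exact InBaker.of_subset_zeroSet _ (X 0 * (X 0 - 1) : MvPolynomial (Fin 1) ℚ)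
        ⟨fun _ => 2, by norm_num⟩ fun v hv => hTA hv
    · -- the wall `x = 1`
      refine InBaker.sqrt_rational 3 0 2 (by norm_num) (by norm_num)
        (Polynomial.C (γ / 9) * (Polynomial.C 3 * Polynomial.X ^ 2 + Polynomial.C 2))
        (Polynomial.X ^ 2 + 1) 0 1 (fun x _ _ => by simp; positivity) _ (fun v hv => ?_) fun v hv => ?_
      · exact_mod_cast (hw v (hTS hv)).1
      · obtain ⟨-, h⟩ : v ∈ S ∧ 2 * ζ v ^ 2 = 1 + v 0 ^ 2 := hTA hv
        have h6 : 6 * ζ v ^ 2 - 1 = 3 * v 0 ^ 2 + 2 := by linarith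
        rw [KZ.IntegralRep.integrand_restrict, hint (hTS hv)]
        beta_reduce
        rw [ppot_spec, h6]
        simp only [qD, map_mul, map_add, map_pow, Polynomial.aeval_C, Polynomial.aeval_X, map_one,
          eq_ratCast]
        push_cast
        ring_nf
    · -- the wall `D = 0`: the primitive vanishes
      refine InBaker.of_mem_relations (KZ.of_mem_relations_of_eqOn_zero _ fun v hv => ?_)
      obtain ⟨-, h⟩ : v ∈ S ∧ 6 * ζ v ^ 2 = 1 := hTA hv
      have h0 : 6 * ζ v ^ 2 - 1 = 0 := by linarith
      rw [KZ.IntegralRep.integrand_restrict, hint (hTS hv)]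
      beta_reduce
      rw [ppot_spec, h0]
      simp

/-- **THE SECTOR.**  `[A, γ√(3x² + 3y² − 1)] ∈ InBaker` for every representation with domain the sector
`A` and that integrand: the elliptic-polar chart with `κ₀ = κ₁ = 1/2` (`InBaker.of_psector`) and the
section dispatcher `inBaker_specA_section`. [KontsevichZagier2001 §1.2 rules (2),(3); this node] -/
theorem inBaker_specA (γ : ℚ) (σ : KZ.IntegralRep 2) (hσ : σ.domain = specA)
    (hσi : ∀ w ∈ σ.domain, σ.integrand w = ellW (1 / 2) (1 / 2) γ 6 (-1) w) :
    InBaker (KZ.of σ) := by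
  refine InBaker.of_psector hκ_half γ 6 (-1) (by norm_num) σ (by rw [hσ]; exact isOpen_specA)
    (fun w hw => ?_) (fun w hw => ?_) (fun w hw => by rw [hσi w hw, ellW])
    fun S ζ hS hζ _ hfr r₁ hr₁ hr₁i => ?_
  · rw [hσ] at hw
    obtain ⟨⟨h1, h10, h01⟩, -⟩ := hw
    refine ⟨h1, h10, ?_⟩
    have hw0 : 0 < w 0 := h1.trans h10
    push_cast
    nlinarith [mul_pos hw0 (sub_pos.2 h01), mul_pos h1 (sub_pos.2 (h10.trans h01))]
  · rw [hσ] at hw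
    obtain ⟨-, hq⟩ := hw
    push_cast
    linarith
  · rw [hσ] at hfr
    exact inBaker_specA_section γ S ζ hS hζ hfr r₁ hr₁ hr₁i

/-! #### 33.5 The specimen end to end -/

/-- **ONE E-TYPE SECTOR SPECIMEN, END TO END.**  For the pointless positive-definite discriminant
`D = 3x² + 3y² − 1`: `[ {0 < x < 1, 0 < y < 1, D > 0}, γ√D ] ∈ InBaker` — rule (1) along the diagonal
(`InBaker.of_partition`; the diagonal is a null zero set), the swap (rule (2)) for the upper sector, and
`inBaker_specA` for the sector `0 < y < x`. [KontsevichZagier2001 §1.2; this node] -/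
theorem inBaker_posdef_specimen (γ : ℚ) (ρ : KZ.IntegralRep 2) (hdom : ρ.domain = specT)
    (hint : ∀ w ∈ ρ.domain, ρ.integrand w = (γ : ℝ) * √(3 * w 0 ^ 2 + 3 * w 1 ^ 2 - 1)) :
    InBaker (KZ.of ρ) := by
  classical
  have hP0 : IsSemialgebraic ℚ {w : Fin 2 → ℝ | w 1 < w 0} := by
    simpa using isSemialgebraic_setOf_eval_lt (k := ℚ) (R := ℝ) (X 1 : MvPolynomial (Fin 2) ℚ) (X 0)
  have hP1 : IsSemialgebraic ℚ {w : Fin 2 → ℝ | w 0 < w 1} := by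
    simpa using isSemialgebraic_setOf_eval_lt (k := ℚ) (R := ℝ) (X 0 : MvPolynomial (Fin 2) ℚ) (X 1)
  have hP2 : IsSemialgebraic ℚ {w : Fin 2 → ℝ | w 1 = w 0} := by
    convert isSemialgebraic_setOf_eval_eq_zero (k := ℚ) (R := ℝ) (X 1 - X 0 : MvPolynomial (Fin 2) ℚ)
      using 1
    ext w
    simp [sub_eq_zero]
  have hAs : IsSemialgebraic ℚ specA := by
    rw [← specT_inter_lt, ← hdom]
    exact ρ.isSemialgebraic_domain.inter hP0
  have hb : Bornology.IsBounded specA := (Metric.isBounded_Icc (0 : Fin 2 → ℝ) 1).subset specA_subset_Icc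
  have key : ∀ (k : Fin 3) (x : Fin 2 → ℝ),
      x ∈ (![{w | w 1 < w 0}, {w | w 0 < w 1}, {w | w 1 = w 0}] : Fin 3 → Set (Fin 2 → ℝ)) k →
        (k = 0 ∧ x 1 < x 0) ∨ (k = 1 ∧ x 0 < x 1) ∨ (k = 2 ∧ x 1 = x 0) := by
    intro k x hk
    fin_cases k
    · exact Or.inl ⟨rfl, hk⟩
    · exact Or.inr (Or.inl ⟨rfl, hk⟩)
    · exact Or.inr (Or.inr ⟨rfl, hk⟩)
  refine InBaker.of_partition (Finset.univ : Finset (Fin 3)) ρ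
    ![{w | w 1 < w 0}, {w | w 0 < w 1}, {w | w 1 = w 0}] ?_ ?_ ?_ ?_
  · intro i _
    fin_cases i
    · exact hP0
    · exact hP1
    · exact hP2
  · intro x _
    rcases lt_trichotomy (x 1) (x 0) with h | h | h
    · exact ⟨0, Finset.mem_univ _, h⟩
    · exact ⟨2, Finset.mem_univ _, h⟩
    · exact ⟨1, Finset.mem_univ _, h⟩
  · intro i j x hij hi hj
    rcases key i x hi with ⟨rfl, h₁⟩ | ⟨rfl, h₁⟩ | ⟨rfl, h₁⟩ <;>
      rcases key j x hj with ⟨rfl, h₂⟩ | ⟨rfl, h₂⟩ | ⟨rfl, h₂⟩ <;>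
      first | exact hij rfl | linarith
  · intro i _ T hT hTr hTeq
    fin_cases i
    · -- the sector `y < x`
      have hTA : T = specA := by rw [hTeq, hdom]; exact specT_inter_lt
      exact inBaker_specA γ (ρ.restrict T hT hTr) hTA fun w hw => by
        rw [KZ.IntegralRep.integrand_restrict, hint w (hTr hw), ellW_spec]
    · -- the sector `x < y`, by the swap
      have hTB : T = specT ∩ {w | w 0 < w 1} := by rw [hTeq, hdom]; rfl
      refine InBaker.of_swap (1 / 2) (1 / 2) γ 6 (-1) (ρ.restrict T hT hTr)
        (bddRep specA hAs hb (ellW (1 / 2) (1 / 2) γ 6 (-1)) (isSemialgebraicFunOn_ellW_spec hAs γ)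
          _ fun w hw => abs_ellW_spec_le γ (specA_box hw))
        ?_ (fun w hw => ?_) (fun w _ => rfl) ?_
      · rw [bddRep_domain, KZ.IntegralRep.domain_restrict, hTB, swap_image_specT_inter_gt]
      · rw [KZ.IntegralRep.integrand_restrict, hint w (hTr hw), ellW_spec]
      · exact inBaker_specA γ _ (bddRep_domain ..) fun w _ => rfl
    · -- the diagonal: a null zero set
      refine InBaker.of_subset_zeroSet _ (X 1 - X 0 : MvPolynomial (Fin 2) ℚ) ⟨![1, 0], by simp⟩
        fun v hv => ?_
      have hv' : v ∈ ρ.domain ∩ {w : Fin 2 → ℝ | w 1 = w 0} := hTeq ▸ hv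
      simpa [sub_eq_zero] using hv'.2

end Summit.KontsevichZagierPeriods.RootDecompWalshStrata.ConicDescent.BallCube

end
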